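import Literature.NumberTheory.EllipticCurves.Rank1Residual.Typed.WuthrichUpperBound
import Literature.NumberTheory.EllipticCurves.Rank1Residual.PrintShape
import Literature.NumberTheory.EllipticCurves.Rank1Residual.X11Three
import Literature.NumberTheory.EllipticCurves.Rank1Residual.X11
import Literature.NumberTheory.EllipticCurves.Castella2018.MultiplicativePPartErratum
import HarnessLib

/-!
# Class X11 at `p = 3` (multiplicative `3`, irreducible `E[3]`) — TYPED missing input (cell `b2b-bsdres`)

HONEST FRAMING (run/shared/lean/b2b/bsd-rank1-residual/, verbatim): the goal of the cell is to
DELETE the COMBINATION-SHAPED residual classes for ALL analytic-rank `≤ 1` elliptic curves over `ℚ`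
— "full BSD formula for every rank `≤ 1` curve in class C" assembled STRICTLY from published
theorems — so that the rank-`≤ 1` remainder becomes exactly the CONSTRUCTION-SHAPED classes, which
are TYPED (missing-input `Prop`s), NOT attempted. This is not "finishing BSD".

**The class.** X11 (RESIDUAL-CASES.md §a.2 v3; `Rank1Residual.ClassX11 W p :=
Mult W p ∧ Irr W p ∧ (¬ Ram W p ∨ (r = 1 ∧ ¬ Semistable W) ∨ (r = 1 ∧ p = 3))`) at the prime
`p = 3` is `mult(3) ∧ irr(3) ∧ (¬ram(3) ∨ r = 1)`. Its rank-one clause `IsX11Three W`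
(`X11Three.lean`: `mult(3) ∧ irr(3) ∧ r = 1`; semistable or not, `ram(3)` or not) was ruled
CONSTRUCTION-SHAPED by the cell's referee (REFEREE.md R6.2, 2026-08-18) on the page evidence of
`b2b-bsdres-x11b/X11B-AUDIT.md` §3. Census v3 (`N < 10⁴`): 111 pairs of analytic rank `1`
(44 semistable, 64 non-semistable with `ram(3)`, 3 with `¬ram(3)`; 72 have `N < 5000` and are
in print by Miller 2011, `IsX11Three.bsdp_three_of_conductor_lt`), and 17 pairs of analytic rank
`0` (all `¬ram(3)`, all with `ρ̄_{E,3}` surjective; 15 with `#Ш_an = 1`, 2 — `5808h1`, `8664o1` —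
with `#Ш_an = 9`).

**What kind of object is missing (r = 1).** A rank-one `p`-part theorem at a MULTIPLICATIVE prime
`p = 3`. The only architecture reaching a multiplicative prime in analytic rank one — Castella,
Camb. J. Math. 6 (2018) §5 as repaired by the author's erratum (Thm. A′: Hida family through the
`p`-new weight-2 form + two-variable anticyclotomic main conjecture at `p ‖ N` + the `p ‖ N`
`p`-adic Waldspurger formula + Gross–Zagier + the rank-zero `p`-part for a twist) — uses at `p = 3`
three objects whose only printed constructions carry standing hypotheses excluding `3`:
* big Heegner points: B. Howard, *Variation of Heegner points in Hida families*, Invent. Math. 167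
  (2007) 91–128, Hypothesis 1.0.1 (arXiv:1202.6358 p. 3): "the following hypotheses are assumed
  throughout: `p ∤ 6N`; …";
* the two-variable anticyclotomic `p`-adic `L`-function over the Hida family and its explicit
  reciprocity law: F. Castella, J. Inst. Math. Jussieu 19 (2020) 2127–2164, §1, first sentence
  (arXiv:1410.6591 p. 3): "Let `p ≥ 5` be a prime";
* the `p ‖ N` `p`-adic Waldspurger formula on the ordinary locus: F. Castella, J. Inst. Math.
  Jussieu 17 (2018) 207–240, §1 (arXiv:1507.04260 p. 3): "Fix a prime `p ≥ 5`", p. 6: "Let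
  `E_{p−1}` be the normalized Eisenstein series of weight `p−1` (recall that `p ≥ 5`)".
No published alternative reaches `p ‖ N` in rank one at any `p` (Skinner–Zhang arXiv:1407.1099 is
unrefereed and "`p ≥ 5` throughout"; Burungale–Castella–Skinner 2025, BCGS 2026, BLV 2026,
Yan–Zhu 2026 are good-reduction theorems).

**Closest published / announced results, verbatim, and why they do not reach the class.**
* Jetchev–Skinner–Wan, Camb. J. Math. 5 (2017) Thm. 1.2.1 (arXiv:1512.06894 p. 3): "Let `p ≥ 3` be
  a prime of good reduction (i.e., `p ∤ N`) …; if `p = 3`, [the formula] holds provided `a_p(E) = 0`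
  when `E` has supersingular reduction at `p`"; §7.4 (v): "The condition that `p` be a prime of good
  reduction can likely be relaxed to at least a prime of multiplicative reduction" — NOT done there.
  Fails on the class: `IsX11Three.not_hasGoodReductionAtPrime` (multiplicative excludes good).
* Skinner, Pacific J. Math. 283 (2016) Thm. C: "good ordinary or multiplicative reduction at a prime
  `p ≥ 3` … If `L(E,1) ≠ 0` then `|L(E,1)/Ω_E|_p^{-1} = |#Ш(E)∏_ℓ c_ℓ(E)|_p^{-1}`" — `p = 3` and
  multiplicative `p` allowed, but analytic rank `0` only (`IsX11Three.entireLFunction_one_eq_zero`).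
* Castella, Erratum to Camb. J. Math. 6 (2018) (web, n.d.; unrefereed; ⇐ Fouquet–Wan
  arXiv:2107.13726 Thm. 4.41, unrefereed), Thm. A′ (p. 1): "Let `E/ℚ` be an elliptic curve of
  conductor `N` with multiplicative reduction at `p > 3`. Assume that `E[p]` is irreducible as a
  `G_ℚ`-module, `E` has nonsplit multiplicative reduction at some prime `q ≠ p` where `E[p]` is
  ramified, and `E(ℚ_p)[p] = 0`. If `ord_{s=1} L(E,s) = 1`, then
  `ord_p(L'(E,1)/(Reg(E/ℚ)·Ω_E)) = ord_p(#Ш(E/ℚ)∏_{ℓ∣N} c_ℓ(E/ℚ))`" — tree binder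
  `Castella2018.erratum_thmAprime_padicVal_bsd_rankOne_OPEN` (`5 ≤ p`). Excludes `p = 3` by
  hypothesis (`three_not_above_castella_or_skinnerZhang_threshold`); ANNOUNCED, not published, even
  for `p ≥ 5`. (The printed Thm. A, "`p > 3`", semistable, is withdrawn at `p ‖ N` by this erratum.)
* Skinner–Zhang, arXiv:1407.1099v1 Thm. 1.2: "let `p ≥ 5` be a prime" — unrefereed since 2014.

**This file** (definitions + bookkeeping theorems; explicit binders; nothing asserted):
* `X11.AprimeLocusAt W p` — the EXTRA hypotheses of Thm. A′ at the pair `(E,p)`, transcribed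
  exactly as in the tree binder: a NONSPLIT multiplicative prime `q ≠ p` with `p ∤ v_q(Δ_min)`
  (`E[p]` ramified at `q`), and `E(ℚ_p)[p] = 0`; it implies the census predicate `ram(p)`.
* `X11.AprimeShapeAt W p := X11.AprimeLocusAt W p → PPart W p` — the A′-SHAPED rank-one statement
  AT the pair, in the cell's single print-shape currency `PPart` (REFEREE R6.7; under `irr(p)` the
  torsion term of `PPart` vanishes, `pPart_of_noTorsionShape`, so this is A′'s display verbatim).
  For `p ≥ 5` it is supplied, CONDITIONALLY, by the announced binder
  (`X11.aprimeShapeAt_of_erratum_OPEN`); at `p = 3` by nothing, published or announced.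
* `X11Three.MissingInputAt W := X11.AprimeShapeAt W 3` — **the typed missing input of the
  construction-shaped clause `r = 1 ∧ p = 3`** (REFEREE R6.2/R6.5): the `p = 3` specialisation, at
  the pair, of the announced statement, WITH its side conditions — so that the universally
  quantified "`∀ E ∈ IsX11Three`, `X11Three.MissingInputAt`" is exactly Thm. A′ with "`p > 3`"
  replaced by "`p = 3`", never a stronger claim. On the class it is equivalent to "A′-locus ⇒
  Miller's last clause of `BSD(E,3)`" (`X11.aprimeShapeAt_iff_missingPPartAt`, currency of
  `Typed/Basic.lean`), and it yields `BSDp W 3` on the A′-locus (`X11Three.bsdp_of_missingInputAt`).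
  OFF the A′-locus (census: 34 of the 111 rank-one pairs, job j039928 — no nonsplit ramified `q`,
  or `E(ℚ_3)[3] ≠ 0` for `2892a1, 3084c1, 5754f1`) not even a hypothetical specialisation of an
  announced statement applies; there the missing input is the bare output `MissingPPartAt W 3`.
  Flag `CAS18-ERR-ram2` (REFEREE R8.1, on the finding X11B-AUDIT.md §10): Castella 2018 §5 — hence
  the erratum's "same argument" — closes, AS PRINTED, only with a SECOND ramified multiplicative
  prime `ℓ ∉ {p, q}` (hypothesis (ram2), transcribed below as the sub-locus `X11.AprimeRam2LocusAt`;
  the locus `X11.AprimeLocusAt` and the tree binder stay AS ANNOUNCED); for the cell's bookkeeping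
  "announced-reachable" means A′ ∧ (ram2): at `p = 3` the hypothetical A′ ∧ (ram2)-locus holds
  37 of the 111 rank-one pairs (77 for A′ as announced) — a statement about printed hypotheses, not
  a claim that any theorem is false; nothing exists at `p = 3` either way (R6.2 unchanged).
* The rank-zero clause at `p = 3` (`¬ram(3) ∧ r = 0`; referee R6.3 (iii) RECOMMENDS the `¬ram`
  part construction-shaped, outside the demotion mandate): `X11ThreeRankZero.MissingInputAt W` —
  with `ρ̄_{E,3}` surjective the UPPER bound `ord_3 #Ш ≤ ord_3 #Ш_an` is Wuthrich, Doc. Math. 19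
  (2014) Prop. 21 (in print; `Typed.missingUpperBoundAt_of_wuthrich`; and `BSD(E,3)` outright when
  `3 ∤ #Ш_an`, the PUBLISHED sub-class theorem `bsdp_of_classX11_rankZero_surj_of_shaAn_unit` of
  `X11.lean`, stated for every odd `p`: 15 of the 17 census pairs), so the missing input is the
  LOWER bound `MissingLowerBoundAt W 3`; without surjectivity (irreducible proper image: Wuthrich's
  constant `C` may contain `3`) it is the whole output `MissingPPartAt W 3`. For the 2 surjective
  pairs with `#Ш_an = 9` (`5808h1`, `8664o1`) the lower bound is a FINITE CERTIFICATE, not a missing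
  theorem: Cassels–Tate squareness + `Ш(E)[3] ≠ 0` (`Typed/CasselsLowerBound.lean`,
  `X11ThreeRankZero.missingInputAt_of_casselsTate_of_three_dvd`; certificate per curve, lane's).
* `X11.AprimeRam2LocusAt W p` (gen 3, REFEREE R8.1, flag `CAS18-ERR-ram2`) — the bookkeeping
  sub-locus A′ ∧ (ram2) on which the announced argument closes AS PRINTED (a second ramified
  multiplicative prime `ℓ ∉ {p, q}` for the rank-zero input of the twist `E^D`); inside the
  A′-locus (`X11.aprimeLocusAt_of_aprimeRam2LocusAt`); nothing asserted.
The universally quantified statements "for every pair of the class, the missing input" are not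
Literature statements (no source proves or even announces them at `p = 3`); they live in the cell's
CLASSES.md (row X11, ruling R6.2).

References: audit `b2b-bsdres-x11b/X11B-AUDIT.md` §2–§4bis (cell HOME); REFEREE.md R6.2, R6.3,
R6.5, R6.7; Miller, LMS J. Comput. Math. 14 (2011) §1 [Miller2011LMS]; Wuthrich 2014 Prop. 21
[Wuthrich2014]; JSW 2017 Thm. 1.2.1 [JetchevSkinnerWan2017]; Skinner 2016 Thm. C
[Skinner2016PacificMC]; Castella's erratum Thm. A′ [Castella2018Erratum]; Castella, JIMJ 19
[Castella2019] and JIMJ 17 [Castella2016]; Skinner–Zhang 2014 [SkinnerZhang2014].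
-/

noncomputable section

open scoped Classical

open WeierstrassCurve Literature.NumberTheory.EllipticCurves
  Literature.NumberTheory.EllipticCurves.Rank1Residual
  Literature.NumberTheory.EllipticCurves.Wuthrich2014

namespace Literature.NumberTheory.EllipticCurves.Rank1Residual.Typed

/-! ### The A′-type side conditions and the A′-shaped statement at a pair `(E, p)` -/

/-- **The A′-locus at `(E, p)`**: the extra hypotheses of Castella's erratum, Thm. A′ (p. 1) — "`E`
has nonsplit multiplicative reduction at some prime `q ≠ p` where `E[p]` is ramified, and
`E(ℚ_p)[p] = 0`" — transcribed EXACTLY as the binders `hq`, `htors` of the tree's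
`Castella2018.erratum_thmAprime_padicVal_bsd_rankOne_OPEN` (globally minimal `W`; "`E[p]` ramified
at the multiplicative `q`" = `p ∤ v_q(Δ_min)`, Tate's parametrisation; "`E(ℚ_p)[p] = 0`" = every
`ℚ_p`-point killed by `p` is zero on `W/ℚ_p`). A predicate on `(W, p)` (no claim), decidable curve
by curve (cell job j039928); nothing is asserted and no prime threshold is built in.
[cite: Castella2018Erratum, Thm. A′ (p. 1), hypotheses, and Remark (1)–(2) (pp. 1–2) (shape only; nothing asserted)] -/
def X11.AprimeLocusAt (W : WeierstrassCurve ℚ) [W.IsGloballyMinimal] (p : ℕ) [Fact p.Prime] : Prop :=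
  (∃ (q : ℕ) (_ : Fact q.Prime), q ≠ p ∧ W.HasMultiplicativeReductionAtPrime q ∧
      ¬ W.HasSplitMultiplicativeReductionAtPrime q ∧ ¬ p ∣ padicValInt q W.minimalDiscriminantInt) ∧
    ∀ P : (W.baseChange ℚ_[p]).toAffine.Point, p • P = 0 → P = 0

/-- **The A′-shaped rank-one statement AT the pair `(E, p)`**: on the A′-locus, the print shape
`ord_p(L^{(r)}(E,1)/(r!·Ω_E·Reg)) = ord_p(#Ш·∏ c_ℓ) − 2·ord_p #E(ℚ)_tors` (`PPart W p`, the cell's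
single print-shape currency; the torsion term is `0` under `irr(p)`, so for an X11 pair this is the
display of Thm. A′ verbatim). For `p ≥ 5` and an X11 pair of analytic rank one it is supplied —
CONDITIONALLY — by the announced, unrefereed Thm. A′ (`X11.aprimeShapeAt_of_erratum_OPEN`); at
`p = 3` no published or announced statement supplies it. A predicate on `(W, p)` (no claim: the
announced statement itself is the binder `Castella2018.erratum_thmAprime_padicVal_bsd_rankOne_OPEN`,
`5 ≤ p`); nothing asserted.
[cite: Castella2018Erratum, Thm. A′ (p. 1), display (shape only; nothing asserted)] -/
def X11.AprimeShapeAt (W : WeierstrassCurve ℚ) [W.IsGloballyMinimal] (p : ℕ) [Fact p.Prime] : Prop :=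
  X11.AprimeLocusAt W p → PPart W p

/-- **MISSING INPUT (construction-shaped; NOT a cited fact; nothing in print or announced supplies
it).** The typed missing input of the residual clause X11 ∧ `p = 3` ∧ `r = 1` (`IsX11Three`:
`3 ‖ N`, `E[3]` irreducible, `ord_{s=1} L(E,s) = 1`; REFEREE.md R6.2: CONSTRUCTION-SHAPED) AT the
pair `(E, 3)`: the `p = 3` specialisation of the A′-shaped statement — IF `E` has nonsplit
multiplicative reduction at some `q ≠ 3` with `3 ∤ v_q(Δ_min)` and `E(ℚ_3)[3] = 0`, THEN
`L'(E,1)/(Ω_E·Reg(E/ℚ))` is a rational number of `3`-adic valuation `ord_3 #Ш(E/ℚ) + ord_3 ∏ c_ℓ`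
(`− 2·ord_3 #E(ℚ)_tors = 0`). The side conditions are kept so that "for all `E` in the class,
`MissingInputAt`" is literally the announced Thm. A′ with "`p > 3`" replaced by "`p = 3`" — never a
stronger claim. Objects missing in print at `p = 3` behind it: big Heegner points (Howard 2007,
Hyp. 1.0.1 "`p ∤ 6N`"), the two-variable anticyclotomic `3`-adic `L`-function over the Hida family
through the `3`-new weight-2 form with its explicit reciprocity law (Castella, JIMJ 19 (2020) §1
"`p ≥ 5`"), the `3 ‖ N` `p`-adic Waldspurger formula on the ordinary locus (Castella, JIMJ 17 (2018)
§1 "`p ≥ 5`", `E_{p−1}`). Bookkeeping definition of the cell (RESIDUAL-CASES.md §a.2 row X11);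
a predicate on `W`, nothing asserted.
[cite: Castella2018Erratum, Thm. A′ (p. 1) with "p > 3" read as "p = 3" (shape only; nothing asserted)] -/
def X11Three.MissingInputAt (W : WeierstrassCurve ℚ) [W.IsGloballyMinimal] : Prop :=
  X11.AprimeShapeAt W 3

/-- **Typed missing input of the rank-zero clause of X11 at `p = 3`** (`mult(3) ∧ irr(3) ∧ ¬ram(3)
∧ r = 0`; REFEREE.md R6.3 (iii) recommends the `¬ram` part construction-shaped — no (ram)-free
integral Iwasawa-theoretic input at `p ‖ N` is in print or announced). With `ρ̄_{E,3}` SURJECTIVE the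
upper bound `ord_3 #Ш ≤ ord_3 #Ш_an` is Wuthrich, Doc. Math. 19 (2014) Prop. 21 (in print), so the
missing input is the LOWER bound `ord_3 #Ш_an ≤ ord_3 #Ш` (`MissingLowerBoundAt`); with an
irreducible NON-surjective image (Wuthrich's constant `C` may then contain `3`) it is the whole
output `MissingPPartAt W 3`. A predicate on `W`; nothing asserted; NOT a cited fact.
[cite: Wuthrich2014, Prop. 21 (p. 400) (shape only; nothing asserted)] [cite: Miller2011LMS, Def. 1.1 (shape only; nothing asserted)] -/
def X11ThreeRankZero.MissingInputAt (W : WeierstrassCurve ℚ) : Prop :=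
  (W.HasSurjectiveModNGaloisRep 3 → MissingLowerBoundAt W 3) ∧
    (¬ W.HasSurjectiveModNGaloisRep 3 → MissingPPartAt W 3)

variable {W : WeierstrassCurve ℚ} {p : ℕ} [Fact p.Prime]

/-! ### Bookkeeping: where the locus sits, and what supplies the shape at `p ≥ 5` -/

/-- The A′-locus implies the census predicate `ram(p)` (forget "nonsplit" and the local-torsion
clause): x11a's `ram_of_erratumAprime_hypothesis`. So `X11 ∧ ¬ram(p)` is off the locus at every `p`.
[claim: Castella2018Erratum, status: under-review] -/
theorem X11.ram_of_aprimeLocusAt [W.IsGloballyMinimal] (h : X11.AprimeLocusAt W p) : Ram W p :=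
  ram_of_erratumAprime_hypothesis h.1

/-- At `p = 3`, an X11 pair ON the A′-locus with `ord_{s=1} L(E,s) ≤ 1` is automatically of
analytic rank one, i.e. in `IsX11Three` (the disjunct `¬ram(3)` of `ClassX11 W 3` is excluded by
the locus). Bookkeeping. [folklore] -/
theorem X11Three.isX11Three_of_classX11_of_aprimeLocusAt [W.IsGloballyMinimal]
    (hX : ClassX11 W 3) (hloc : X11.AprimeLocusAt W 3) : IsX11Three W := by
  refine ⟨hX.1, hX.2.1, ?_⟩
  rcases hX.2.2 with h | h | h
  · exact absurd (X11.ram_of_aprimeLocusAt hloc) h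
  · exact h.1
  · exact h.1

/-- Under `irr(p)` the cell's print-shape currency `PPart W p` (torsion term included) and the
no-torsion display of JSW Thm. 1.2.1 / Castella Thm. A′ / Skinner–Zhang Thm. 1.2 are the same
statement: `ord_p #E(ℚ)_tors = 0` (Mazur 1977; `padicValNat_torsionOrder_eq_zero_of_irreducible`).
Bookkeeping (one direction is `pPart_of_noTorsionShape`). [cite: Mazur1977, Ch. III §5, p. 157] -/
theorem X11.pPart_iff_noTorsionShape [W.IsElliptic] (hirr : W.HasIrreducibleModPGaloisRep p) :
    PPart W p ↔
      ∃ q : ℚ, W.leadingLCoeff / ((W.realPeriodRat * W.regulator : ℝ) : ℂ) = (q : ℂ) ∧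
        padicValRat p q = (padicValNat p W.shaOrder : ℤ) + padicValNat p W.tamagawaProduct := by
  refine ⟨fun ⟨q, hq, hv⟩ => ⟨q, hq, ?_⟩, pPart_of_noTorsionShape W p hirr⟩
  rw [hv, padicValNat_torsionOrder_eq_zero_of_irreducible W p hirr]
  simp

/-- **At `p ≥ 5` the A′-shaped statement at an X11-type pair of analytic rank one is supplied —
CONDITIONALLY — by the announced binder** `Castella2018.erratum_thmAprime_padicVal_bsd_rankOne_OPEN`
(web erratum, unrefereed, ⇐ Fouquet–Wan arXiv:2107.13726 Thm. 4.41): multiplicative `p`, `E[p]`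
irreducible, `r_an = 1`, `Ш` finite by Gross–Zagier–Kolyvagin (`hGZK`, bsd.S17). The point of the
lemma is the CONTRAST: the same term with `5 ≤ p` replaced by `p = 3` is `X11Three.MissingInputAt`,
for which no binder of any status exists. NOT a deletion of anything.
[claim: Castella2018Erratum, status: under-review] -/
theorem X11.aprimeShapeAt_of_erratum_OPEN [W.IsElliptic] [W.IsGloballyMinimal]
    (hA' : Castella2018.erratum_thmAprime_padicVal_bsd_rankOne_OPEN)
    (hGZK : rank_eq_analyticRank_of_analyticRank_le_one) (hp : 5 ≤ p)
    (hmult : W.HasMultiplicativeReductionAtPrime p) (hirr : W.HasIrreducibleModPGaloisRep p)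
    (hr : W.analyticRank = 1) : X11.AprimeShapeAt W p := by
  intro hloc
  obtain ⟨-, hfin⟩ := hGZK W (le_of_eq hr)
  exact pPart_of_noTorsionShape W p hirr (hA' W p hp hmult hirr hloc.1 hloc.2 hr hfin)

/-! ### The two currencies agree: A′-shape versus Miller's last clause (`Typed/Basic.lean`) -/

/-- **Miller's last clause ⇒ the print shape** (converse of `missingPPartAt_of_pPart`; pure
bookkeeping with `#Ш_an = (L^{(r)}(E,1)/r!)·#E(ℚ)_tors²/(Ω·∏ c_ℓ·Reg)`, `shaAn_def`): if `#Ш(E/ℚ)_an`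
is a rational `q` with `ord_p q = ord_p #Ш` and `L^{(r)}(E,1) ≠ 0` (`hL`; e.g. modularity, or
`r ≥ 1`), then `L^{(r)}(E,1)/(r!·Ω·Reg) = q·∏ c_ℓ/#E(ℚ)_tors²` is rational with
`ord_p = ord_p #Ш + ord_p ∏ c_ℓ − 2·ord_p #E(ℚ)_tors`, i.e. `PPart W p`.
[cite: Miller2011LMS, §1 and Def. 1.1 (arXiv:1010.2431 p. 3)] -/
theorem pPart_of_missingPPartAt [W.IsElliptic] (hL : W.leadingLCoeff ≠ 0)
    (h : MissingPPartAt W p) : PPart W p := by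
  obtain ⟨q, hq, hv⟩ := h
  have hΩ : (0 : ℝ) < W.realPeriodRat := W.realPeriodRat_pos_holds
  have hR : (0 : ℝ) < W.regulator := W.regulator_pos'
  have hc0 : 0 < W.tamagawaProduct := W.tamagawaProduct_pos_holds
  have ht0 : 0 < W.torsionOrder := W.torsionOrder_pos_holds
  have hΩ' : (W.realPeriodRat : ℂ) ≠ 0 := by exact_mod_cast hΩ.ne'
  have hR' : (W.regulator : ℂ) ≠ 0 := by exact_mod_cast hR.ne'
  have hcC : (W.tamagawaProduct : ℂ) ≠ 0 := by exact_mod_cast hc0.ne'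
  have htC : (W.torsionOrder : ℂ) ≠ 0 := by exact_mod_cast ht0.ne'
  -- `q ≠ 0` from `L^{(r)}(E,1) ≠ 0`
  have hq0 : q ≠ 0 := by
    rintro rfl
    rw [shaAn_def, Rat.cast_zero, div_eq_zero_iff] at hq
    rcases hq with h1 | h2
    · exact (mul_ne_zero hL (pow_ne_zero 2 htC)) h1
    · exact (mul_ne_zero (mul_ne_zero hΩ' hcC) hR') h2
  refine ⟨q * (W.tamagawaProduct : ℚ) / (W.torsionOrder : ℚ) ^ 2, ?_, ?_⟩
  · -- `L^{(r)}(E,1)/(r!·Ω·Reg) = q · ∏ c_ℓ / #tors²`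
    have hsha : W.leadingLCoeff * (W.torsionOrder : ℂ) ^ 2 =
        (q : ℂ) * ((W.realPeriodRat : ℂ) * (W.tamagawaProduct : ℂ) * (W.regulator : ℂ)) := by
      rw [← div_eq_iff (mul_ne_zero (mul_ne_zero hΩ' hcC) hR'), ← shaAn_def, hq]
    have hLq : W.leadingLCoeff =
        (q : ℂ) * ((W.realPeriodRat : ℂ) * (W.tamagawaProduct : ℂ) * (W.regulator : ℂ)) /
          (W.torsionOrder : ℂ) ^ 2 := by
      rw [eq_div_iff (pow_ne_zero 2 htC), hsha]
    rw [hLq]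
    push_cast
    field_simp
  · -- valuations
    have ht : (W.torsionOrder : ℚ) ≠ 0 := by exact_mod_cast ht0.ne'
    have hc : (W.tamagawaProduct : ℚ) ≠ 0 := by exact_mod_cast hc0.ne'
    rw [padicValRat.div (mul_ne_zero hq0 hc) (pow_ne_zero 2 ht), padicValRat.mul hq0 hc,
      padicValRat.pow (W.torsionOrder : ℚ), padicValRat.of_nat, padicValRat.of_nat, hv]
    ring

/-- **On a pair with `ord_{s=1} L(E,s) ≤ 1`, the A′-shaped statement is exactly "A′-locus ⇒ Miller's
last clause of `BSD(E,p)`"** (`MissingPPartAt W p` of `Typed/Basic.lean`), granted modularity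
(`hmod`, for `L^{(r)}(E,1) ≠ 0`) and Gross–Zagier–Kolyvagin (`hGZK`): the typed input is neither
weaker than what `BSD(E,p)` needs nor stronger than the announced shape. Bookkeeping
(`missingPPartAt_of_pPart`, `pPart_of_missingPPartAt`).
[cite: Miller2011LMS, §1 and Def. 1.1 (arXiv:1010.2431 p. 3)] -/
theorem X11.aprimeShapeAt_iff_missingPPartAt [W.IsElliptic] [W.IsGloballyMinimal]
    (hmod : hasEntireLFunction_rat)
    (hGZK : rank_eq_analyticRank_of_analyticRank_le_one) (hr : W.analyticRank ≤ 1) :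
    X11.AprimeShapeAt W p ↔ (X11.AprimeLocusAt W p → MissingPPartAt W p) :=
  ⟨fun h hloc => missingPPartAt_of_pPart W p hmod hGZK hr (h hloc),
    fun h hloc => pPart_of_missingPPartAt (W.leadingLCoeff_ne_zero_holds (hmod W)) (h hloc)⟩

/-! ### Conditional class theorems (the typed input, if ever supplied at the pair, closes the pair) -/

/-- **X11 ∧ `p = 3` ∧ `r = 1`, conditional class theorem.** For `E/ℚ` (globally minimal `W`) with
`ord_{s=1} L(E,s) ≤ 1`, in class X11 at `p = 3` and ON the A′-locus (so `r = 1`,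
`X11Three.isX11Three_of_classX11_of_aprimeLocusAt`), the typed missing input at `(E,3)` yields
Miller's `BSD(E,3)` — through the cell's bridge `bsdp_of_padicVal_printShape` (irr(3) kills the
torsion term; Gross–Zagier–Kolyvagin `hGZK` = bsd.S17 for `rank = r_an` and `Ш` finite). NOTHING in
print or announced supplies `hmiss`; this records only that the TYPE is the right one. Off the
locus the analogous statement is `bsdp_of_missingPPartAt W 3` of `Typed/Basic.lean`.
[cite: Miller2011LMS, §1 and Def. 1.1 (arXiv:1010.2431 p. 3)] -/
theorem X11Three.bsdp_of_missingInputAt (hGZK : rank_eq_analyticRank_of_analyticRank_le_one)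
    (W : WeierstrassCurve ℚ) [W.IsElliptic] [W.IsGloballyMinimal] (hr : W.analyticRank ≤ 1)
    (hX : ClassX11 W 3) (hloc : X11.AprimeLocusAt W 3) (hmiss : X11Three.MissingInputAt W) :
    BSDp W 3 :=
  bsdp_of_padicVal_printShape W 3 hGZK hr hX.2.1
    ((X11.pPart_iff_noTorsionShape hX.2.1).1 (hmiss hloc))

/-- **X11 ∧ `p = 3` ∧ `r = 0`, conditional class theorem.** For `E/ℚ` (globally minimal `W`) with
`ord_{s=1} L(E,s) = 0`, in class X11 at `p = 3` (multiplicative `3` ⇒ not additive; the class then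
forces `¬ram(3)`), the typed missing input `X11ThreeRankZero.MissingInputAt W` yields `BSD(E,3)`:
with surjective `ρ̄_{E,3}` the published half is Wuthrich 2014 Prop. 21 (`hW`, via
`bsdp_of_missingLowerBoundAt_of_wuthrich`; modularity `hmod` for `r_an = 0 ⇒ L(E,1) ≠ 0`), otherwise
the whole output is the hypothesis (`bsdp_of_missingPPartAt`). Gross–Zagier–Kolyvagin `hGZK`.
[cite: Wuthrich2014, Prop. 21 (p. 400)] [cite: Miller2011LMS, §1 and Def. 1.1] -/
theorem X11ThreeRankZero.bsdp_of_missingInputAt (hW : sha_dvd_analyticSha)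
    (hGZK : rank_eq_analyticRank_of_analyticRank_le_one) (hmod : hasEntireLFunction_rat)
    (W : WeierstrassCurve ℚ) [W.IsElliptic] [W.IsGloballyMinimal] (hr : W.analyticRank = 0)
    (hX : ClassX11 W 3) (hmiss : X11ThreeRankZero.MissingInputAt W) : BSDp W 3 := by
  by_cases hs : W.HasSurjectiveModNGaloisRep 3
  · have hadd : ¬ ((W.baseChange ℚ_[3]).minimal ℤ_[3]).HasAdditiveReduction ℤ_[3] :=
      WeierstrassCurve.HasMultiplicativeReduction.not_hasAdditiveReduction (R := ℤ_[3]) hX.1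
    exact bsdp_of_missingLowerBoundAt_of_wuthrich W 3 hW hGZK hmod (by decide) hr hadd (Or.inr hs)
      (hmiss.1 hs)
  · exact bsdp_of_missingPPartAt W 3 hGZK (by omega) (hmiss.2 hs)

/-- **X11 at `p = 3`, both clauses.** For `E/ℚ` (globally minimal `W`) with `ord_{s=1} L(E,s) ≤ 1`
in class X11 at `p = 3`: in analytic rank `0` the rank-zero typed input, in analytic rank `1` ON the
A′-locus the A′-shaped typed input and OFF it the bare output `MissingPPartAt W 3`, each yield
`BSD(E,3)` (named facts: Wuthrich Prop. 21 `hW`, GZK `hGZK`, modularity `hmod`). The PUBLISHED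
sub-classes need none of this: `N_E < 5000` (`bsdp_three_of_classX11_of_conductor_lt`, Miller 2011)
and `r = 0 ∧ surj(3) ∧ 3 ∤ #Ш_an` (`bsdp_of_classX11_rankZero_surj_of_shaAn_unit`, Wuthrich).
Bookkeeping assembly; nothing in print supplies the rank-one inputs.
[cite: Miller2011LMS, §1 and Def. 1.1] [cite: Wuthrich2014, Prop. 21 (p. 400)] -/
theorem X11.bsdp_three_of_typedInputs (hW : sha_dvd_analyticSha)
    (hGZK : rank_eq_analyticRank_of_analyticRank_le_one) (hmod : hasEntireLFunction_rat)
    (W : WeierstrassCurve ℚ) [W.IsElliptic] [W.IsGloballyMinimal] (hr : W.analyticRank ≤ 1)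
    (hX : ClassX11 W 3) (h0 : W.analyticRank = 0 → X11ThreeRankZero.MissingInputAt W)
    (h1 : W.analyticRank = 1 → X11.AprimeLocusAt W 3 → X11Three.MissingInputAt W)
    (h1' : W.analyticRank = 1 → ¬ X11.AprimeLocusAt W 3 → MissingPPartAt W 3) : BSDp W 3 := by
  rcases Nat.le_one_iff_eq_zero_or_eq_one.mp hr with hr0 | hr1
  · exact X11ThreeRankZero.bsdp_of_missingInputAt hW hGZK hmod W hr0 hX (h0 hr0)
  · by_cases hloc : X11.AprimeLocusAt W 3
    · exact X11Three.bsdp_of_missingInputAt hGZK W hr hX hloc (h1 hr1 hloc)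
    · exact bsdp_of_missingPPartAt W 3 hGZK hr (h1' hr1 hloc)

/-! ### Bookkeeping sub-locus (ram2): where the announced argument closes AS PRINTED (REFEREE R8.1) -/

/-- **The A′ ∧ (ram2) sub-locus at `(E, p)`** (REFEREE.md R8.1, flag `CAS18-ERR-ram2`; finding
`b2b-bsdres-x11b/X11B-AUDIT.md` §10): the hypotheses of Castella's erratum Thm. A′ — a NONSPLIT
multiplicative prime `q ≠ p` with `p ∤ v_q(Δ_min)` and `E(ℚ_p)[p] = 0`, exactly as in
`X11.AprimeLocusAt` — TOGETHER WITH a second multiplicative prime `ℓ ∉ {p, q}` with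
`p ∤ v_ℓ(Δ_min)` (`E[p]` ramified at `ℓ`). Reason, from the printed texts (a statement about
PRINTED hypotheses, not a claim that any theorem is false): Castella, Camb. J. Math. 6 (2018) §5
(arXiv:1704.06608 p. 12) chooses the imaginary quadratic field `K` with the ramified-representation
prime `q` RAMIFIED in `K` and closes "by the known `p`-part of the Birch and Swinnerton-Dyer formula
for `E^D` (as recalled in [JSW])" = Jetchev–Skinner–Wan Thm. 7.2.1 (ii) ⇐ Skinner 2016 Thm. C (ii),
which asks for a multiplicative prime `≠ p` of `E^D` at which `E^D[p]` is ramified; `E^D` is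
additive at `q ∣ D`, so that prime is a second one, `ℓ`; the erratum's Thm. A′ is proved by "the same
argument". Ruling R8.1: (i) the tree binder `Castella2018.erratum_thmAprime_padicVal_bsd_rankOne_OPEN`
and the locus `X11.AprimeLocusAt` transcribe A′ AS ANNOUNCED and are unchanged; (ii) for the cell's
census / CLASSES / paper bookkeeping "announced-reachable (A′)" means THIS sub-locus. Census (cell
job j039928; lane to certify): T-CAS pairs `5/12`; X11 ∧ `r = 1` ∧ `p ≥ 5`, `N < 10⁴`: `1/10`
(`7110m1@5`); `p = 3`: `37/111` (hypothetical — A′ does not exist at `3`; `77/111` for A′ as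
announced). A predicate on `(W, p)`; nothing asserted; no prime threshold built in.
[cite: Castella2018, §5 (arXiv:1704.06608 p. 12) (shape only; nothing asserted)]
[cite: Skinner2016PacificMC, Thm. C (ii) (shape only; nothing asserted)]
[cite: Castella2018Erratum, Thm. A′ (p. 1) (shape only; nothing asserted)] -/
def X11.AprimeRam2LocusAt (W : WeierstrassCurve ℚ) [W.IsGloballyMinimal] (p : ℕ) [Fact p.Prime] :
    Prop :=
  (∃ (q : ℕ) (_ : Fact q.Prime) (ℓ : ℕ) (_ : Fact ℓ.Prime), q ≠ p ∧ ℓ ≠ p ∧ ℓ ≠ q ∧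
      W.HasMultiplicativeReductionAtPrime q ∧ ¬ W.HasSplitMultiplicativeReductionAtPrime q ∧
      ¬ p ∣ padicValInt q W.minimalDiscriminantInt ∧
      W.HasMultiplicativeReductionAtPrime ℓ ∧ ¬ p ∣ padicValInt ℓ W.minimalDiscriminantInt) ∧
    ∀ P : (W.baseChange ℚ_[p]).toAffine.Point, p • P = 0 → P = 0

/-- The A′ ∧ (ram2) sub-locus lies inside the A′-locus (forget `ℓ`). Bookkeeping. [folklore] -/
theorem X11.aprimeLocusAt_of_aprimeRam2LocusAt [W.IsGloballyMinimal]
    (h : X11.AprimeRam2LocusAt W p) : X11.AprimeLocusAt W p := by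
  obtain ⟨⟨q, hq, ℓ, hℓ, hqp, -, -, hmq, hns, hvq, -, -⟩, htors⟩ := h
  exact ⟨⟨q, hq, hqp, hmq, hns, hvq⟩, htors⟩

/-- On the sub-locus the census predicate `ram(p)` holds (twice over); so `X11 ∧ ¬ram(p)` is off it,
as it is off the A′-locus. Bookkeeping. [folklore] -/
theorem X11.ram_of_aprimeRam2LocusAt [W.IsGloballyMinimal] (h : X11.AprimeRam2LocusAt W p) :
    Ram W p :=
  X11.ram_of_aprimeLocusAt (X11.aprimeLocusAt_of_aprimeRam2LocusAt h)

/-- On the sub-locus the (ram2) prime `ℓ` is itself a witness of `ram(p)` DIFFERENT from the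
nonsplit prime `q`: there are two distinct multiplicative primes `≠ p` at which `E[p]` is ramified
(the shape of Skinner–Zhang's hypothesis (e), cf. `ram_of_skinnerZhang_hypotheses`). Bookkeeping.
[folklore] -/
theorem X11.exists_two_ramified_of_aprimeRam2LocusAt [W.IsGloballyMinimal]
    (h : X11.AprimeRam2LocusAt W p) :
    ∃ (q : ℕ) (_ : Fact q.Prime) (ℓ : ℕ) (_ : Fact ℓ.Prime), q ≠ p ∧ ℓ ≠ p ∧ ℓ ≠ q ∧
      W.HasMultiplicativeReductionAtPrime q ∧ ¬ p ∣ padicValInt q W.minimalDiscriminantInt ∧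
      W.HasMultiplicativeReductionAtPrime ℓ ∧ ¬ p ∣ padicValInt ℓ W.minimalDiscriminantInt := by
  obtain ⟨⟨q, hq, ℓ, hℓ, hqp, hℓp, hℓq, hmq, -, hvq, hmℓ, hvℓ⟩, -⟩ := h
  exact ⟨q, hq, ℓ, hℓ, hqp, hℓp, hℓq, hmq, hvq, hmℓ, hvℓ⟩

/-- **At `p = 3`, conditional class theorem on the sub-locus** (pure restriction of
`X11Three.bsdp_of_missingInputAt` to A′ ∧ (ram2); recorded so that the cell's "announced-reachable"
bookkeeping at `p = 3` — `37/111` pairs, hypothetical — has a kernel name). NOTHING in print or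
announced supplies `hmiss` at `p = 3`. [cite: Miller2011LMS, §1 and Def. 1.1 (arXiv:1010.2431 p. 3)] -/
theorem X11Three.bsdp_of_missingInputAt_of_aprimeRam2LocusAt
    (hGZK : rank_eq_analyticRank_of_analyticRank_le_one)
    (W : WeierstrassCurve ℚ) [W.IsElliptic] [W.IsGloballyMinimal] (hr : W.analyticRank ≤ 1)
    (hX : ClassX11 W 3) (hloc : X11.AprimeRam2LocusAt W 3) (hmiss : X11Three.MissingInputAt W) :
    BSDp W 3 :=
  X11Three.bsdp_of_missingInputAt hGZK W hr hX (X11.aprimeLocusAt_of_aprimeRam2LocusAt hloc) hmiss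

end Literature.NumberTheory.EllipticCurves.Rank1Residual.Typed
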